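import Mathlib
import Literature.Analysis.OperatorTheory.HeterogeneousCyclicPeeling
import HarnessLib

/-!
# Cyclic chains with a symmetrised transfer kernel: conditional expectation given the slices

Pure measure theory behind the Osterwalder–Seiler time slicing of a lattice gauge theory with periodic time (companion
of `HeterogeneousCyclicPeeling.lean`).  On a cyclic product
`(ZMod T → X) × (ZMod T → Y)` of probability spaces ("spatial slices" `X`, "temporal layers" `Y`), for a slice energy
`Ssp : X → ℝ` and a layer energy `Stm : X → Y → X → ℝ` (bounded above, measurable), the symmetrised kernel
`K a b = e^{Ssp a/2} (∫ e^{Stm a e b} de) e^{Ssp b/2}` and the normalised layer density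
`q a e b = e^{Stm a e b}/∫ e^{Stm a e' b} de'` — `K` and `q` enter as variables with their defining equations as
hypotheses, so that no definition is introduced — we prove:

* `integral_mul_eq_integral_mul_integral_of_dependsOn` — functions of disjoint coordinate blocks of a product
  probability measure integrate multiplicatively;
* `integral_mul_exp_sum_eq` (**main**) — integrating out the layers: for a bounded measurable `Ψ` depending on the
  layers `E t`, `t ∈ D` only, `∫ Ψ e^{Σ_t (Ssp(V t) + Stm(V t, E t, V(t+1)))} = ∫ CE_D[Ψ](V) ∏_t K(V t, V (t+1)) dV` with
  the conditional expectation `CE_D[Ψ](V) = ∫ Ψ(V, E) ∏_{t ∈ D} q(V t, E t, V (t+1)) dE` given the slices;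
* `abs_condexp_le_one`, `measurable_condexp`, `condexp_congr_of_eqOn`, `condexp_mul_eq`, `condexp_shift` — `CE_D` is
  bounded by `1`, measurable, local in the slices, multiplicative over disjoint layer blocks, shift covariant.
References: K. Osterwalder, E. Seiler, Ann. Phys. 110 (1978) 440, §2; E. Seiler, LNP 159 (1982) Ch. 2.
-/

set_option autoImplicit false

noncomputable section

open scoped BigOperators
open MeasureTheory Filter Function

namespace Literature.Analysis.OperatorTheory.CyclicChain

/-! ### Products over a block and its complement -/

section Blocks

variable {ι : Type*} [Fintype ι] [DecidableEq ι] {M : Type*} [CommMonoid M]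

/-- `∏_{i ∈ D} f i = ∏_i (if i ∈ D then f i else 1)`. [folklore] -/
theorem prod_mem_eq_prod_ite (D : Finset ι) (f : ι → M) : ∏ i ∈ D, f i = ∏ i, (if i ∈ D then f i else 1) := by
  rw [Finset.prod_ite_mem, Finset.univ_inter]

/-- `∏_{i ∈ Dᶜ} f i = ∏_i (if i ∈ D then 1 else f i)`. [folklore] -/
theorem prod_compl_eq_prod_ite (D : Finset ι) (f : ι → M) : ∏ i ∈ Dᶜ, f i = ∏ i, (if i ∈ D then 1 else f i) :=
  (prod_mem_eq_prod_ite _ _).trans (Finset.prod_congr rfl fun i _ => by by_cases h : i ∈ D <;> simp [h])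

end Blocks

/-! ### Functions of disjoint coordinate blocks integrate multiplicatively -/

section Factorisation

variable {ι : Type*} [Fintype ι] [DecidableEq ι] {Y : Type*} [MeasurableSpace Y] (μY : Measure Y)
  [IsProbabilityMeasure μY]

/-- **Independence of disjoint coordinate blocks.** Under a product probability measure, a function of the coordinates
in `D` and a function of the coordinates outside `D` integrate multiplicatively (no measurability needed:
`Literature.Analysis.OperatorTheory.integral_pi_mul_split` and `integral_prod_mul`). [folklore] -/
theorem integral_mul_eq_integral_mul_integral_of_dependsOn (D : Finset ι) (f g : (ι → Y) → ℝ)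
    (hf : ∀ E E', (∀ i ∈ D, E i = E' i) → f E = f E')
    (hg : ∀ E E', (∀ i, i ∉ D → E i = E' i) → g E = g E') :
    ∫ E, f E * g E ∂(Measure.pi fun _ : ι => μY) =
      (∫ E, f E ∂(Measure.pi fun _ : ι => μY)) * ∫ E, g E ∂(Measure.pi fun _ : ι => μY) := by
  obtain ⟨y₀⟩ := nonempty_of_isProbabilityMeasure μY
  set a : ({i // i ∈ D} → Y) → ℝ := fun x => f fun i => if h : i ∈ D then x ⟨i, h⟩ else y₀ with ha
  set b : ({i // ¬ i ∈ D} → Y) → ℝ := fun x => g fun i => if h : i ∈ D then y₀ else x ⟨i, h⟩ with hb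
  have hfa : ∀ E : ι → Y, f E = a fun i => E i := fun E =>
    hf _ _ fun i hi => by simp [hi]
  have hgb : ∀ E : ι → Y, g E = b fun i => E i := fun E =>
    hg _ _ fun i hi => by simp [hi]
  have h := Literature.Analysis.OperatorTheory.integral_pi_mul_split (fun i => i ∈ D) μY a b
  have h1 := Literature.Analysis.OperatorTheory.integral_pi_mul_split (fun i => i ∈ D) μY a fun _ => 1
  have h2 := Literature.Analysis.OperatorTheory.integral_pi_mul_split (fun i => i ∈ D) μY (fun _ => 1) b
  simp only [mul_one, one_mul, integral_const, smul_eq_mul, probReal_univ] at h1 h2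
  simp_rw [hfa, hgb]
  rw [h, h1, h2]

end Factorisation

/-! ### Cyclic chains: integrating out the layers -/

section Chain

variable {T : ℕ} [NeZero T] {X Y : Type*} [MeasurableSpace X] [MeasurableSpace Y]
  (μX : Measure X) (μY : Measure Y) [IsProbabilityMeasure μX] [IsProbabilityMeasure μY]
  (Ssp : X → ℝ) (Stm : X → Y → X → ℝ) (K : X → X → ℝ) (q : X → Y → X → ℝ)

omit [MeasurableSpace X] in
/-- The symmetrised product: `(∏_t e^{S(V t)}) ∏_t M(V t, V(t+1)) = ∏_t e^{S(V t)/2} M(V t, V(t+1)) e^{S(V(t+1))/2}`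
(reindex `t + 1 ↦ t` around the cycle). [folklore] -/
theorem prod_exp_mul_prod_eq (S : X → ℝ) (Mk : X → X → ℝ) (V : ZMod T → X) :
    (∏ t, Real.exp (S (V t))) * ∏ t, Mk (V t) (V (t + 1)) =
      ∏ t, Real.exp (S (V t) / 2) * Mk (V t) (V (t + 1)) * Real.exp (S (V (t + 1)) / 2) := by
  rw [Finset.prod_mul_distrib, Finset.prod_mul_distrib]
  have hshift : ∏ t : ZMod T, Real.exp (S (V (t + 1)) / 2) = ∏ t, Real.exp (S (V t) / 2) :=
    Fintype.prod_equiv (Equiv.addRight 1) _ _ fun t => rfl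
  have hsq : (fun t : ZMod T => Real.exp (S (V t))) =
      fun t => Real.exp (S (V t) / 2) * Real.exp (S (V t) / 2) := by
    funext t; rw [← Real.exp_add]; ring_nf
  rw [hshift, hsq, Finset.prod_mul_distrib]
  ring

/-- The layer partition function `Z(a, b) = ∫ e^{Stm a e b} de` is positive (bounded measurable integrand). [folklore] -/
theorem integral_exp_layer_pos (hStm : Measurable fun p : X × Y × X => Stm p.1 p.2.1 p.2.2)
    {B : ℝ} (hStmB : ∀ a e b, Stm a e b ≤ B) (a b : X) : 0 < ∫ e, Real.exp (Stm a e b) ∂μY := by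
  refine integral_exp_pos (Integrable.of_bound ?_ (Real.exp B) (Eventually.of_forall fun e => ?_))
  · exact (hStm.comp (measurable_const.prodMk (measurable_id.prodMk measurable_const))).exp.aestronglyMeasurable
  · rw [Real.norm_eq_abs, Real.abs_exp]
    exact Real.exp_le_exp.2 (hStmB a e b)

/-- The layer partition function is jointly measurable in the two slices. [folklore] -/
theorem measurable_integral_exp_layer (hStm : Measurable fun p : X × Y × X => Stm p.1 p.2.1 p.2.2) :
    Measurable fun ab : X × X => ∫ e, Real.exp (Stm ab.1 e ab.2) ∂μY := by
  have h : Measurable fun p : (X × X) × Y => Real.exp (Stm p.1.1 p.2 p.1.2) :=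
    (hStm.comp (measurable_fst.fst.prodMk (measurable_snd.prodMk measurable_fst.snd))).exp
  exact (h.stronglyMeasurable.integral_prod_right' (ν := μY)).measurable

/-- The normalised layer density is jointly measurable. [folklore] -/
theorem measurable_layerDensity (hStm : Measurable fun p : X × Y × X => Stm p.1 p.2.1 p.2.2)
    (hq : ∀ a e b, q a e b = Real.exp (Stm a e b) / ∫ e', Real.exp (Stm a e' b) ∂μY) :
    Measurable fun p : X × Y × X => q p.1 p.2.1 p.2.2 := by
  have h : (fun p : X × Y × X => q p.1 p.2.1 p.2.2) =
      fun p => Real.exp (Stm p.1 p.2.1 p.2.2) / ∫ e', Real.exp (Stm p.1 e' p.2.2) ∂μY := funext fun p => hq _ _ _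
  rw [h]
  exact hStm.exp.div ((measurable_integral_exp_layer μY Stm hStm).comp (measurable_fst.prodMk measurable_snd.snd))

omit [MeasurableSpace X] [IsProbabilityMeasure μY] in
/-- The normalised layer density is non-negative. [folklore] -/
theorem layerDensity_nonneg (hq : ∀ a e b, q a e b = Real.exp (Stm a e b) / ∫ e', Real.exp (Stm a e' b) ∂μY)
    (a : X) (e : Y) (b : X) : 0 ≤ q a e b :=
  (hq a e b).symm ▸ div_nonneg (Real.exp_pos _).le (integral_nonneg fun _ => (Real.exp_pos _).le)

/-- The normalised layer density integrates to `1`. [folklore] -/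
theorem integral_layerDensity (hStm : Measurable fun p : X × Y × X => Stm p.1 p.2.1 p.2.2)
    {B : ℝ} (hStmB : ∀ a e b, Stm a e b ≤ B)
    (hq : ∀ a e b, q a e b = Real.exp (Stm a e b) / ∫ e', Real.exp (Stm a e' b) ∂μY) (a b : X) :
    ∫ e, q a e b ∂μY = 1 := by
  simp_rw [hq, integral_div]
  exact div_self (integral_exp_layer_pos μY Stm hStm hStmB a b).ne'

/-- The block density `∏_{t ∈ D} q(V t, E t, V(t+1))` integrates to `1` over the layers. [folklore] -/
theorem integral_prod_layerDensity (hStm : Measurable fun p : X × Y × X => Stm p.1 p.2.1 p.2.2)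
    {B : ℝ} (hStmB : ∀ a e b, Stm a e b ≤ B)
    (hq : ∀ a e b, q a e b = Real.exp (Stm a e b) / ∫ e', Real.exp (Stm a e' b) ∂μY)
    (D : Finset (ZMod T)) (V : ZMod T → X) :
    ∫ E, ∏ t ∈ D, q (V t) (E t) (V (t + 1)) ∂(Measure.pi fun _ : ZMod T => μY) = 1 := by
  classical
  simp_rw [prod_mem_eq_prod_ite D]
  have h := integral_fintype_prod_eq_prod (𝕜 := ℝ) (μ := fun _ : ZMod T => μY)
    (fun (t : ZMod T) (e : Y) => if t ∈ D then q (V t) e (V (t + 1)) else 1)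
  have h' : (fun E : ZMod T → Y => ∏ t, (if t ∈ D then q (V t) (E t) (V (t + 1)) else 1)) =
      fun E => ∏ t, (fun (t : ZMod T) (e : Y) => if t ∈ D then q (V t) e (V (t + 1)) else 1) t (E t) := by
    funext E; refine Finset.prod_congr rfl fun t _ => ?_; by_cases ht : t ∈ D <;> simp [ht]
  rw [h', h]
  refine Finset.prod_eq_one fun t _ => ?_
  by_cases ht : t ∈ D
  · simp only [ht, if_true]; exact integral_layerDensity μY Stm q hStm hStmB hq _ _
  · simp [ht]

omit [MeasurableSpace X] [MeasurableSpace Y] in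
/-- The Boltzmann weight of the sliced energy factorises: `e^{Σ_t (Ssp(V t) + Stm_t)} = (∏_t e^{Ssp(V t)}) ∏_t e^{Stm_t}`.
[folklore] -/
theorem exp_sum_add_eq (V : ZMod T → X) (E : ZMod T → Y) : Real.exp (∑ t, (Ssp (V t) + Stm (V t) (E t) (V (t + 1)))) =
    (∏ t, Real.exp (Ssp (V t))) * ∏ t, Real.exp (Stm (V t) (E t) (V (t + 1))) := by
  rw [Finset.sum_add_distrib, Real.exp_add, Real.exp_sum, Real.exp_sum]

/-- **Integrating out the layers (conditional expectation given the slices).**  For a bounded measurable functional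
`Ψ` of slices and layers depending on the layers `E t`, `t ∈ D` only,
`∫ Ψ e^{Σ_t (Ssp(V t) + Stm(V t, E t, V(t+1)))} d(V, E) = ∫ CE_D[Ψ](V) ∏_t K(V t, V(t+1)) dV`, where
`CE_D[Ψ](V) = ∫ Ψ(V, E) ∏_{t ∈ D} q(V t, E t, V(t+1)) dE` is the conditional expectation of `Ψ` given the slices (the
layers are conditionally independent with the normalised densities `q`) and `K` is the symmetrised transfer kernel
(Fubini; the layers outside `D` integrate to the kernel factors, `integral_mul_eq_integral_mul_integral_of_dependsOn`).
[cite: OsterwalderSeiler1978, §2] -/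
theorem integral_mul_exp_sum_eq (hSsp : Measurable Ssp) (hStm : Measurable fun p : X × Y × X => Stm p.1 p.2.1 p.2.2)
    {B : ℝ} (hSspB : ∀ a, Ssp a ≤ B) (hStmB : ∀ a e b, Stm a e b ≤ B)
    (hK : ∀ a b, K a b = Real.exp (Ssp a / 2) * (∫ e, Real.exp (Stm a e b) ∂μY) * Real.exp (Ssp b / 2))
    (hq : ∀ a e b, q a e b = Real.exp (Stm a e b) / ∫ e', Real.exp (Stm a e' b) ∂μY)
    (Ψ : (ZMod T → X) × (ZMod T → Y) → ℝ) (hΨ : Measurable Ψ) {BΨ : ℝ} (hΨB : ∀ p, |Ψ p| ≤ BΨ)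
    (D : Finset (ZMod T)) (hΨD : ∀ V E E', (∀ t ∈ D, E t = E' t) → Ψ (V, E) = Ψ (V, E')) :
    ∫ p, Ψ p * Real.exp (∑ t, (Ssp (p.1 t) + Stm (p.1 t) (p.2 t) (p.1 (t + 1))))
        ∂((Measure.pi fun _ : ZMod T => μX).prod (Measure.pi fun _ : ZMod T => μY)) =
      ∫ V, (∫ E, Ψ (V, E) * ∏ t ∈ D, q (V t) (E t) (V (t + 1)) ∂(Measure.pi fun _ : ZMod T => μY)) *
        ∏ t, K (V t) (V (t + 1)) ∂(Measure.pi fun _ : ZMod T => μX) := by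
  classical
  set μV : Measure (ZMod T → X) := Measure.pi fun _ : ZMod T => μX with hμV
  set μE : Measure (ZMod T → Y) := Measure.pi fun _ : ZMod T => μY with hμE
  -- integrability on the product
  have hSm : Measurable fun p : (ZMod T → X) × (ZMod T → Y) =>
      ∑ t, (Ssp (p.1 t) + Stm (p.1 t) (p.2 t) (p.1 (t + 1))) := by
    refine Finset.measurable_sum _ fun t _ => ?_
    have hV : ∀ s : ZMod T, Measurable fun p : (ZMod T → X) × (ZMod T → Y) => p.1 s := fun s =>
      (measurable_pi_apply s).comp measurable_fst
    have hE : Measurable fun p : (ZMod T → X) × (ZMod T → Y) => p.2 t :=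
      (measurable_pi_apply t).comp measurable_snd
    have h3 : Measurable fun p : (ZMod T → X) × (ZMod T → Y) => (p.1 t, p.2 t, p.1 (t + 1)) :=
      (hV t).prodMk (hE.prodMk (hV (t + 1)))
    exact ((hSsp.comp (hV t)).add (hStm.comp h3) :)
  have hSb : ∀ p : (ZMod T → X) × (ZMod T → Y),
      ∑ t, (Ssp (p.1 t) + Stm (p.1 t) (p.2 t) (p.1 (t + 1))) ≤ ∑ _t : ZMod T, (B + B) := fun p =>
    Finset.sum_le_sum fun t _ => add_le_add (hSspB _) (hStmB _ _ _)
  have hint : Integrable (fun p : (ZMod T → X) × (ZMod T → Y) =>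
      Ψ p * Real.exp (∑ t, (Ssp (p.1 t) + Stm (p.1 t) (p.2 t) (p.1 (t + 1))))) (μV.prod μE) := by
    refine Integrable.of_bound (hΨ.mul hSm.exp).aestronglyMeasurable (BΨ * Real.exp (∑ _t : ZMod T, (B + B)))
      (Eventually.of_forall fun p => ?_)
    rw [norm_mul, Real.norm_eq_abs, Real.norm_eq_abs, Real.abs_exp]
    exact mul_le_mul (hΨB p) (Real.exp_le_exp.2 (hSb p)) (Real.exp_pos _).le ((abs_nonneg _).trans (hΨB p))
  rw [integral_prod _ hint]
  refine integral_congr_ae (Eventually.of_forall fun V => ?_)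
  dsimp only
  -- notation for the fixed slice configuration `V`
  set Z : ZMod T → ℝ := fun t => ∫ e, Real.exp (Stm (V t) e (V (t + 1))) ∂μY with hZ
  have hZpos : ∀ t, 0 < Z t := fun t => integral_exp_layer_pos μY Stm hStm hStmB _ _
  have hZne : ∀ t, Z t ≠ 0 := fun t => (hZpos t).ne'
  set ρ : ZMod T → Y → ℝ := fun t e => Real.exp (Stm (V t) e (V (t + 1))) with hρ
  -- the weight factorises; the layers in `D` and outside `D` separate
  have h1 : ∀ E : ZMod T → Y, Ψ (V, E) * Real.exp (∑ t, (Ssp (V t) + Stm (V t) (E t) (V (t + 1)))) =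
      (∏ t, Real.exp (Ssp (V t))) *
        ((Ψ (V, E) * ∏ t ∈ D, ρ t (E t)) * ∏ t ∈ Dᶜ, ρ t (E t)) := fun E => by
    rw [exp_sum_add_eq, mul_assoc (Ψ (V, E)), Finset.prod_mul_prod_compl]
    ring
  simp_rw [h1]
  rw [integral_const_mul, integral_mul_eq_integral_mul_integral_of_dependsOn μY D
    (fun E => Ψ (V, E) * ∏ t ∈ D, ρ t (E t)) (fun E => ∏ t ∈ Dᶜ, ρ t (E t))]
  rotate_left
  · intro E E' hEE'
    rw [hΨD V E E' hEE']
    congr 1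
    exact Finset.prod_congr rfl fun t ht => by rw [hEE' t ht]
  · intro E E' hEE'
    exact Finset.prod_congr rfl fun t ht => by rw [hEE' t (Finset.mem_compl.1 ht)]
  -- the layers outside `D` integrate to `∏_{t ∉ D} Z t`
  have h2 : ∫ E, ∏ t ∈ Dᶜ, ρ t (E t) ∂μE = ∏ t ∈ Dᶜ, Z t := by
    simp_rw [prod_compl_eq_prod_ite D]
    have h := integral_fintype_prod_eq_prod (𝕜 := ℝ) (μ := fun _ : ZMod T => μY)
      (fun (t : ZMod T) (e : Y) => if t ∈ D then (1 : ℝ) else ρ t e)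
    have h' : (fun E : ZMod T → Y => ∏ t, (if t ∈ D then (1 : ℝ) else ρ t (E t))) =
        fun E => ∏ t, (fun (t : ZMod T) (e : Y) => if t ∈ D then (1 : ℝ) else ρ t e) t (E t) := by
      funext E; refine Finset.prod_congr rfl fun t _ => ?_; by_cases ht : t ∈ D <;> simp [ht]
    rw [h', h]
    refine Finset.prod_congr rfl fun t _ => ?_
    by_cases ht : t ∈ D <;> simp [ht, hρ, hZ]
  -- the layers in `D` give `(∏_{t ∈ D} Z t) · CE_D[Ψ](V)`
  have h3 : ∫ E, Ψ (V, E) * ∏ t ∈ D, ρ t (E t) ∂μE =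
      (∫ E, Ψ (V, E) * ∏ t ∈ D, q (V t) (E t) (V (t + 1)) ∂μE) * ∏ t ∈ D, Z t := by
    have hqρ : ∀ E : ZMod T → Y, ∏ t ∈ D, q (V t) (E t) (V (t + 1)) = (∏ t ∈ D, ρ t (E t)) / ∏ t ∈ D, Z t :=
      fun E => by
        rw [← Finset.prod_div_distrib]
        exact Finset.prod_congr rfl fun t _ => by rw [hq]
    simp_rw [hqρ, mul_div_assoc', integral_div]
    rw [div_mul_cancel₀ _ (Finset.prod_ne_zero_iff.2 fun t _ => hZne t)]
  rw [h2, h3]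
  -- regroup the kernel
  have h4 : (∏ t, Real.exp (Ssp (V t))) * ∏ t, Z t = ∏ t, K (V t) (V (t + 1)) := by
    rw [prod_exp_mul_prod_eq Ssp (fun a b => ∫ e, Real.exp (Stm a e b) ∂μY) V]
    exact Finset.prod_congr rfl fun t _ => by rw [hK]
  rw [← h4, ← Finset.prod_mul_prod_compl D Z]
  ring

/-- **The conditional expectation of a functional bounded by `1` is bounded by `1`.** [folklore] -/
theorem abs_condexp_le_one (hStm : Measurable fun p : X × Y × X => Stm p.1 p.2.1 p.2.2)
    {B : ℝ} (hStmB : ∀ a e b, Stm a e b ≤ B)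
    (hq : ∀ a e b, q a e b = Real.exp (Stm a e b) / ∫ e', Real.exp (Stm a e' b) ∂μY)
    (Ψ : (ZMod T → X) × (ZMod T → Y) → ℝ) (hΨ1 : ∀ p, |Ψ p| ≤ 1) (D : Finset (ZMod T)) (V : ZMod T → X) :
    |∫ E, Ψ (V, E) * ∏ t ∈ D, q (V t) (E t) (V (t + 1)) ∂(Measure.pi fun _ : ZMod T => μY)| ≤ 1 := by
  classical
  have hqm : Measurable fun E : ZMod T → Y => ∏ t ∈ D, q (V t) (E t) (V (t + 1)) := by
    refine Finset.measurable_prod _ fun t _ => ?_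
    have h3 : Measurable fun E : ZMod T → Y => (V t, E t, V (t + 1)) :=
      measurable_const.prodMk ((measurable_pi_apply t).prodMk measurable_const)
    exact ((measurable_layerDensity μY Stm q hStm hq).comp h3 :)
  have hq0 : ∀ E : ZMod T → Y, 0 ≤ ∏ t ∈ D, q (V t) (E t) (V (t + 1)) := fun E =>
    Finset.prod_nonneg fun t _ => layerDensity_nonneg μY Stm q hq _ _ _
  have hqb : ∀ E : ZMod T → Y, ∏ t ∈ D, q (V t) (E t) (V (t + 1)) ≤
      ∏ t ∈ D, Real.exp B / ∫ e', Real.exp (Stm (V t) e' (V (t + 1))) ∂μY := fun E =>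
    Finset.prod_le_prod (fun t _ => layerDensity_nonneg μY Stm q hq _ _ _) fun t _ => by
      rw [hq]
      exact div_le_div_of_nonneg_right (Real.exp_le_exp.2 (hStmB _ _ _))
        (integral_exp_layer_pos μY Stm hStm hStmB _ _).le
  have hqi : Integrable (fun E : ZMod T → Y => ∏ t ∈ D, q (V t) (E t) (V (t + 1))) (Measure.pi fun _ : ZMod T => μY) :=
    Integrable.of_bound hqm.aestronglyMeasurable _ (Eventually.of_forall fun E => by
      rw [Real.norm_eq_abs, abs_of_nonneg (hq0 E)]; exact hqb E)
  have h := norm_integral_le_of_norm_le hqi (Eventually.of_forall fun E => show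
      ‖Ψ (V, E) * ∏ t ∈ D, q (V t) (E t) (V (t + 1))‖ ≤ ∏ t ∈ D, q (V t) (E t) (V (t + 1)) by
    rw [norm_mul, Real.norm_eq_abs, Real.norm_eq_abs, abs_of_nonneg (hq0 E)]
    exact mul_le_of_le_one_left (hq0 E) (hΨ1 _))
  rw [integral_prod_layerDensity μY Stm q hStm hStmB hq D V] at h
  rwa [Real.norm_eq_abs] at h

/-- **The conditional expectation of a measurable functional is measurable in the slices.** [folklore] -/
theorem measurable_condexp (hStm : Measurable fun p : X × Y × X => Stm p.1 p.2.1 p.2.2)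
    (hq : ∀ a e b, q a e b = Real.exp (Stm a e b) / ∫ e', Real.exp (Stm a e' b) ∂μY)
    (Ψ : (ZMod T → X) × (ZMod T → Y) → ℝ) (hΨ : Measurable Ψ) (D : Finset (ZMod T)) :
    Measurable fun V : ZMod T → X =>
      ∫ E, Ψ (V, E) * ∏ t ∈ D, q (V t) (E t) (V (t + 1)) ∂(Measure.pi fun _ : ZMod T => μY) := by
  classical
  have h : Measurable fun p : (ZMod T → X) × (ZMod T → Y) => Ψ p * ∏ t ∈ D, q (p.1 t) (p.2 t) (p.1 (t + 1)) := by
    refine hΨ.mul (Finset.measurable_prod _ fun t _ => ?_)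
    have hV : ∀ s : ZMod T, Measurable fun p : (ZMod T → X) × (ZMod T → Y) => p.1 s := fun s =>
      (measurable_pi_apply s).comp measurable_fst
    have hE : Measurable fun p : (ZMod T → X) × (ZMod T → Y) => p.2 t :=
      (measurable_pi_apply t).comp measurable_snd
    have h3 : Measurable fun p : (ZMod T → X) × (ZMod T → Y) => (p.1 t, p.2 t, p.1 (t + 1)) :=
      (hV t).prodMk (hE.prodMk (hV (t + 1)))
    exact ((measurable_layerDensity μY Stm q hStm hq).comp h3 :)
  exact (h.stronglyMeasurable.integral_prod_right' (ν := Measure.pi fun _ : ZMod T => μY)).measurable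

omit [IsProbabilityMeasure μY] [MeasurableSpace X] in
/-- **Locality of the conditional expectation in the slices**: if `Ψ` depends on the slices `V t`, `t ∈ A` only and
`A` contains `t` and `t + 1` for every layer `t ∈ D`, then `CE_D[Ψ]` depends on the slices in `A` only. [folklore] -/
theorem condexp_congr_of_eqOn (Ψ : (ZMod T → X) × (ZMod T → Y) → ℝ) (D : Finset (ZMod T)) (A : Set (ZMod T))
    (hA : ∀ t ∈ D, t ∈ A ∧ t + 1 ∈ A) (hΨA : ∀ V V' E, (∀ t ∈ A, V t = V' t) → Ψ (V, E) = Ψ (V', E))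
    (V V' : ZMod T → X) (hVV' : ∀ t ∈ A, V t = V' t) :
    ∫ E, Ψ (V, E) * ∏ t ∈ D, q (V t) (E t) (V (t + 1)) ∂(Measure.pi fun _ : ZMod T => μY) =
      ∫ E, Ψ (V', E) * ∏ t ∈ D, q (V' t) (E t) (V' (t + 1)) ∂(Measure.pi fun _ : ZMod T => μY) := by
  refine integral_congr_ae (Eventually.of_forall fun E => ?_)
  dsimp only
  rw [hΨA V V' E hVV']
  congr 1
  exact Finset.prod_congr rfl fun t ht => by rw [hVV' t (hA t ht).1, hVV' (t + 1) (hA t ht).2]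

omit [MeasurableSpace X] in
/-- **The conditional expectation is multiplicative over disjoint layer blocks**: if `Ψ₁` depends on the layers in `A`
only and `Ψ₂` on the layers in `B` only, `A ∩ B = ∅`, then `CE_{A ∪ B}[Ψ₁ Ψ₂] = CE_A[Ψ₁] · CE_B[Ψ₂]` (conditional
independence of the layers given the slices). [cite: OsterwalderSeiler1978, §2] -/
theorem condexp_mul_eq (Ψ₁ Ψ₂ : (ZMod T → X) × (ZMod T → Y) → ℝ) (A B : Finset (ZMod T)) (hAB : Disjoint A B)
    (hΨ₁ : ∀ V E E', (∀ t ∈ A, E t = E' t) → Ψ₁ (V, E) = Ψ₁ (V, E'))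
    (hΨ₂ : ∀ V E E', (∀ t ∈ B, E t = E' t) → Ψ₂ (V, E) = Ψ₂ (V, E')) (V : ZMod T → X) :
    ∫ E, Ψ₁ (V, E) * Ψ₂ (V, E) * ∏ t ∈ A ∪ B, q (V t) (E t) (V (t + 1)) ∂(Measure.pi fun _ : ZMod T => μY) =
      (∫ E, Ψ₁ (V, E) * ∏ t ∈ A, q (V t) (E t) (V (t + 1)) ∂(Measure.pi fun _ : ZMod T => μY)) *
        ∫ E, Ψ₂ (V, E) * ∏ t ∈ B, q (V t) (E t) (V (t + 1)) ∂(Measure.pi fun _ : ZMod T => μY) := by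
  classical
  have h1 : ∀ E : ZMod T → Y, Ψ₁ (V, E) * Ψ₂ (V, E) * ∏ t ∈ A ∪ B, q (V t) (E t) (V (t + 1)) =
      (Ψ₁ (V, E) * ∏ t ∈ A, q (V t) (E t) (V (t + 1))) * (Ψ₂ (V, E) * ∏ t ∈ B, q (V t) (E t) (V (t + 1))) :=
    fun E => by rw [Finset.prod_union hAB]; ring
  simp_rw [h1]
  refine integral_mul_eq_integral_mul_integral_of_dependsOn μY A _ _ (fun E E' hEE' => ?_) (fun E E' hEE' => ?_)
  · rw [hΨ₁ V E E' hEE']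
    congr 1
    exact Finset.prod_congr rfl fun t ht => by rw [hEE' t ht]
  · have hB : ∀ t ∈ B, E t = E' t := fun t ht => hEE' t (Finset.disjoint_right.1 hAB ht)
    rw [hΨ₂ V E E' hB]
    congr 1
    exact Finset.prod_congr rfl fun t ht => by rw [hB t ht]

omit [IsProbabilityMeasure μY] in
/-- **The cyclic shift of the layers preserves the product measure.** [folklore] -/
theorem measurePreserving_shift [SigmaFinite μY] (n : ZMod T) :
    MeasurePreserving (fun (E : ZMod T → Y) (t : ZMod T) => E (t + n))
      (Measure.pi fun _ : ZMod T => μY) (Measure.pi fun _ : ZMod T => μY) := by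
  have hm : Measurable fun (E : ZMod T → Y) (t : ZMod T) => E (t + n) :=
    measurable_pi_lambda _ fun t => measurable_pi_apply _
  refine ⟨hm, ?_⟩
  symm
  refine Measure.pi_eq fun s hs => ?_
  rw [Measure.map_apply hm (MeasurableSet.univ_pi hs)]
  have hpre : (fun (E : ZMod T → Y) (t : ZMod T) => E (t + n)) ⁻¹' Set.pi Set.univ s =
      Set.pi Set.univ fun t => s (t - n) := by
    ext E
    simp only [Set.mem_preimage, Set.mem_pi, Set.mem_univ, true_implies]
    constructor
    · intro h t; simpa using h (t - n)
    · intro h t; simpa using h (t + n)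
  rw [hpre]
  simp only [Measure.pi_pi]
  exact Fintype.prod_equiv (Equiv.subRight n) _ _ fun t => rfl

omit [MeasurableSpace X] in
/-- **Covariance of the conditional expectation under the cyclic shift**: shifting slices and layers by `n` inside
`Ψ` and shifting the layer block `D` to `D + n` is the same as evaluating `CE_D[Ψ]` at the shifted slices.
[folklore] -/
theorem condexp_shift (Ψ : (ZMod T → X) × (ZMod T → Y) → ℝ) (D : Finset (ZMod T)) (n : ZMod T) (V : ZMod T → X) :
    ∫ E, Ψ (fun t => V (t + n), fun t => E (t + n)) *
        ∏ s ∈ D.image (fun t => t + n), q (V s) (E s) (V (s + 1)) ∂(Measure.pi fun _ : ZMod T => μY) =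
      ∫ E, Ψ (fun t => V (t + n), E) * ∏ t ∈ D, q (V (t + n)) (E t) (V (t + n + 1))
        ∂(Measure.pi fun _ : ZMod T => μY) := by
  classical
  have h1 : ∀ E : ZMod T → Y, ∏ s ∈ D.image (fun t => t + n), q (V s) (E s) (V (s + 1)) =
      ∏ t ∈ D, q (V (t + n)) ((fun t => E (t + n)) t) (V (t + n + 1)) := fun E => by
    rw [Finset.prod_image fun t _ t' _ h => add_right_cancel h]
  simp_rw [h1]
  let e : (ZMod T → Y) ≃ᵐ (ZMod T → Y) :=
    { toFun := fun E t => E (t + n)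
      invFun := fun E t => E (t - n)
      left_inv := fun E => funext fun t => by simp
      right_inv := fun E => funext fun t => by simp
      measurable_toFun := measurable_pi_lambda _ fun t => measurable_pi_apply _
      measurable_invFun := measurable_pi_lambda _ fun t => measurable_pi_apply _ }
  have he : MeasurePreserving e (Measure.pi fun _ : ZMod T => μY) (Measure.pi fun _ : ZMod T => μY) :=
    measurePreserving_shift (μY := μY) n
  exact he.integral_comp' (fun E' : ZMod T → Y => Ψ (fun t => V (t + n), E') *
    ∏ t ∈ D, q (V (t + n)) (E' t) (V (t + n + 1)))

end Chain

end Literature.Analysis.OperatorTheory.CyclicChain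

end
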